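import Mathlib
import Summits.MatrixMultiplication.MatrixMultiplication.Theorems.FidelityWitnessesFidelityGapThreeSeventeenStubBorelNormalFormExp
import Summits.MatrixMultiplication.MatrixMultiplication.Theorems.FidelityWitnessesFidelityGapThreeSeventeenStubBorelNormalFormBrackets
import Summits.MatrixMultiplication.MatrixMultiplication.Theorems.FidelityWitnessesFidelityGapThreeSeventeenStubBorelNormalFormTorusData

/-!
# Borel normal form, part 11: the general Borel limit theorem

Support file for the Borel normal form of the line's border-apolarity candidates
(`FidelityWitnesses.FidelityGapThreeSeventeen`; usable by any line through the matrix multiplication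
stabiliser): for an ARBITRARY index type `ι` (e.g. all multidegrees of an ideal), a tuple of subspaces
`W i ≤ S (μ i)` and a property `P` of tuples that passes to the limit of each of the eighteen one-parameter
degenerations used here (`exp(s E_{pq})`, `p ≠ q`, with the piecewise truncation order `|μ i| + 1`, tested
through `Hx (-opL X p q) (nOf (μ i))`; the tori of `E_{pp}` tested through `Tw (nT' X p)`), there is a tuple
satisfying `P` and stable under all `opL X p q`, `p ≤ q` — i.e. `IsBFixed` piecewise
(`borel_limit_exists`, `borel_limit_exists_isBFixed`).  The user supplies the closedness of `P` (for the
fat datum of the dead line `symbolic-square-border-apolarity` this is `good_lim` of part 10; for an ideal: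
Hilbert function, apolarity, multiplicativity pass to limits by parts 1–5).  PROVED.
-/

noncomputable section

namespace Summit.MatrixMultiplication.MatrixMultiplication.Theorems.SymbolicSquare

-- single-conjunct summit: the `Summit.<S>.<P>` prefix repeats `MatrixMultiplication` by design (D-0017)
set_option linter.dupNamespace false

open scoped BigOperators Polynomial
open Polynomial

/-! ## The general Borel limit theorem: a `𝔟`-stable limit point of a limit-closed family of tuples -/

section General

open BorelLimit

variable {ι : Type*} (μ : ι → MDeg)

/-- Powers of `-D` vanish where powers of `D` do. -/
theorem neg_pow_apply_eq_zero' {D : Poly →ₗ[ℂ] Poly} {k : ℕ} {f : Poly} (h : (D ^ k) f = 0) : ((-D) ^ k) f = 0 := by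
  rw [show -D = (-1 : ℂ) • D from (neg_one_smul ℂ D).symm, _root_.smul_pow, LinearMap.smul_apply, h, smul_zero]


/-- The truncation order used for the piece of multidegree `m`: `|m| + 1`. -/
def nOf (m : MDeg) : ℕ := m 0 + m 1 + m 2 + 1

/-- **Exponential step (general)**: degenerate a tuple `W` (piece `i` inside `S (μ i)`) along `exp(s D)`,
`D = opL X p q`, `p ≠ q`, each piece with its own truncation order `nOf (μ i)`: any property `P` of tuples
that passes to this limit is kept, stability under already processed operators is inherited (given the
bracket data of a normal series), and stability under `D` is gained. -/
theorem gstep_exp (X p q : Fin 3) (hpq : p ≠ q) (P : (ι → Submodule ℂ Poly) → Prop)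
    (hP : ∀ W, P W → P (fun i => limW (Hx (-opL X p q) (nOf (μ i))) (S (μ i)) (W i)))
    (L : List (Fin 3 × Fin 3 × Fin 3)) (W : ι → Submodule ℂ Poly) (hW : P W)
    (hL : ∀ k ∈ L, ∀ i, ∀ f ∈ W i, opL k.1 k.2.1 k.2.2 f ∈ W i)
    (hB : ∀ k ∈ L, ∃ C : Poly →ₗ[ℂ] Poly,
      opL X p q ∘ₗ opL k.1 k.2.1 k.2.2 - opL k.1 k.2.1 k.2.2 ∘ₗ opL X p q = C ∧ opL X p q ∘ₗ C = C ∘ₗ opL X p q ∧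
        (∀ m, ∀ f ∈ S m, C f ∈ S m) ∧ (∀ i, ∀ f ∈ W i, C f ∈ W i)) :
    ∃ W' : ι → Submodule ℂ Poly, P W' ∧ ∀ k ∈ (X, p, q) :: L, ∀ i, ∀ f ∈ W' i, opL k.1 k.2.1 k.2.2 f ∈ W' i := by
  refine ⟨fun i => limW (Hx (-opL X p q) (nOf (μ i))) (S (μ i)) (W i), hP W hW, ?_⟩
  intro k hk i f hf
  rcases List.mem_cons.1 hk with rfl | hk'
  · exact limW_Hx_stable_self (D := opL X p q) (N := nOf (μ i)) (fun g hg => opL_mem_S X p q (μ i) hg)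
      (fun g hg => opL_pow_eq_zero X p q hpq (μ i) hg (by simp only [nOf]; omega)) f hf
  · obtain ⟨C, hC1, hC2, hC3, hC4⟩ := hB k hk'
    refine limW_Hx_stable_of_bracket (D := -opL X p q) (N := nOf (μ i)) (E := opL k.1 k.2.1 k.2.2) (C' := -C)
      ?_ ?_ (fun g hg => opL_mem_S _ _ _ (μ i) hg) (fun g hg => Submodule.neg_mem _ (hC3 (μ i) g hg))
      (fun g hg => neg_pow_apply_eq_zero' (opL_pow_eq_zero X p q hpq (μ i) hg le_rfl))
      (fun g hg => hL k hk' i g hg) (fun g hg => Submodule.neg_mem _ (hC4 i g hg)) f hf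
    · rw [LinearMap.neg_comp, LinearMap.comp_neg, ← hC1]
      abel
    · rw [LinearMap.neg_comp, LinearMap.comp_neg, LinearMap.neg_comp, LinearMap.comp_neg, neg_neg, neg_neg, hC2]

/-- **Torus step (general)**: degenerate along the one-parameter torus of `opL X p p` (lattice tested
through `Tw (nT' X p)`): `P` is kept, all processed stability is inherited, stability under `opL X p p`
is gained. -/
theorem gstep_tor (X p : Fin 3) (P : (ι → Submodule ℂ Poly) → Prop)
    (hP : ∀ W, P W → P (fun i => limW (Tw (nT' X p)).toLinearMap (S (μ i)) (W i)))
    (L : List (Fin 3 × Fin 3 × Fin 3)) (W : ι → Submodule ℂ Poly) (hW : P W)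
    (hL : ∀ k ∈ L, ∀ i, ∀ f ∈ W i, opL k.1 k.2.1 k.2.2 f ∈ W i) :
    ∃ W' : ι → Submodule ℂ Poly, P W' ∧ ∀ k ∈ (X, p, p) :: L, ∀ i, ∀ f ∈ W' i, opL k.1 k.2.1 k.2.2 f ∈ W' i := by
  refine ⟨fun i => limW (Tw (nT' X p)).toLinearMap (S (μ i)) (W i), hP W hW, ?_⟩
  intro k hk i f hf
  have hSδ : S (μ i) ≤ MvPolynomial.restrictSupport ℂ {d | Finsupp.degree d = μ i 0 + μ i 1 + μ i 2} :=
    S_le_restrictSupport_degree (μ i)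
  have hSw : ∀ j, ∀ g ∈ S (μ i), MvPolynomial.weightedHomogeneousComponent (nT X p) j g ∈ S (μ i) :=
    fun j g hg => whc_mem_weightedHomogeneousSubmodule _ wt (μ i) j hg
  rcases List.mem_cons.1 hk with rfl | hk'
  · exact limW_Tw_stable_diag (nT X p) (nT' X p) 2 (nT_add_nT' X p) _ hSδ hSw (opL X p p)
      (fun j => ⟨(j : ℂ) - ((μ i 0 + μ i 1 + μ i 2 : ℕ) : ℂ), fun g hg => opL_self_whc X p (μ i) j hg⟩) f hf
  · obtain ⟨s₁, s₂, hs⟩ := opL_shift X p k.1 k.2.1 k.2.2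
    refine limW_stable (Tw (nT' X p)).toLinearMap (opL k.1 k.2.1 k.2.2) (fun g hg => opL_mem_S _ _ _ (μ i) hg) s₁
      (LinearMap.mulLeft ℂ (Polynomial.X ^ s₂) ∘ₗ cw (opL k.1 k.2.1 k.2.2)) ?_ ?_ f hf
    · intro G hG
      exact (X_pow_mul_mem_famOf s₂).2 (cw_mem_famOf _ (fun g hg => hL k hk' i g hg) hG)
    · intro F _
      simp only [LinearMap.comp_apply, LinearMap.mulLeft_apply, AlgHom.toLinearMap_apply]
      exact X_pow_mul_Tw_cw (nT' X p) (opL k.1 k.2.1 k.2.2) s₁ s₂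
        (fun d r => MvPolynomial.restrictSupport_mono ℂ (fun d' hd' => hd'.1)
          (lvf_monomial_mem_shift _ _ _ (nT' X p) s₁ s₂ hs d r)) F

variable {μ}

/-- Bracket data for a commuting pair (general tuples). -/
theorem gbracket_zero {D E : Poly →ₗ[ℂ] Poly} {W : ι → Submodule ℂ Poly} (h : D ∘ₗ E - E ∘ₗ D = 0) :
    ∃ C : Poly →ₗ[ℂ] Poly, D ∘ₗ E - E ∘ₗ D = C ∧ D ∘ₗ C = C ∘ₗ D ∧
      (∀ m, ∀ f ∈ S m, C f ∈ S m) ∧ (∀ i, ∀ f ∈ W i, C f ∈ W i) :=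
  ⟨0, h, by simp, fun m f _ => by simp, fun i f _ => by simp⟩

/-- Bracket data for `[E₁₂, E₀₁] = E₀₂` (general tuples). -/
theorem gbracket_one (X : Fin 3) {W : ι → Submodule ℂ Poly} (h02 : ∀ i, ∀ f ∈ W i, opL X 0 2 f ∈ W i) :
    ∃ C : Poly →ₗ[ℂ] Poly, opL X 1 2 ∘ₗ opL X 0 1 - opL X 0 1 ∘ₗ opL X 1 2 = C ∧ opL X 1 2 ∘ₗ C = C ∘ₗ opL X 1 2 ∧
      (∀ m, ∀ f ∈ S m, C f ∈ S m) ∧ (∀ i, ∀ f ∈ W i, C f ∈ W i) := by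
  refine ⟨opL X 0 2, by simpa using opL_bracket X 1 2 0 1, ?_, fun m f hf => opL_mem_S X 0 2 m hf, h02⟩
  exact sub_eq_zero.1 (by simpa using opL_bracket X 1 2 0 2)

variable (μ)

/-- The unipotent stage of factor `X` (general): the three root subgroups `E₀₂, E₀₁, E₁₂`, given the list
`L` of processed operators of the EARLIER factors (all commuting with factor `X`). -/
theorem gstageN (X : Fin 3) (P : (ι → Submodule ℂ Poly) → Prop)
    (hP : ∀ p q, p ≠ q → ∀ W, P W → P (fun i => limW (Hx (-opL X p q) (nOf (μ i))) (S (μ i)) (W i)))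
    (L : List (Fin 3 × Fin 3 × Fin 3)) (hLX : ∀ k ∈ L, k.1 ≠ X) (W : ι → Submodule ℂ Poly) (hW : P W)
    (hL : ∀ k ∈ L, ∀ i, ∀ f ∈ W i, opL k.1 k.2.1 k.2.2 f ∈ W i) :
    ∃ W' : ι → Submodule ℂ Poly, P W' ∧
      ∀ k ∈ (X, (1 : Fin 3), (2 : Fin 3)) :: (X, 0, 1) :: (X, 0, 2) :: L, ∀ i, ∀ f ∈ W' i, opL k.1 k.2.1 k.2.2 f ∈ W' i := by
  have h02 : (0 : Fin 3) ≠ 2 := by decide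
  have h01 : (0 : Fin 3) ≠ 1 := by decide
  have h12 : (1 : Fin 3) ≠ 2 := by decide
  have cross : ∀ (p q : Fin 3) (W₁ : ι → Submodule ℂ Poly), ∀ k ∈ L, ∃ C : Poly →ₗ[ℂ] Poly,
      opL X p q ∘ₗ opL k.1 k.2.1 k.2.2 - opL k.1 k.2.1 k.2.2 ∘ₗ opL X p q = C ∧ opL X p q ∘ₗ C = C ∘ₗ opL X p q ∧
        (∀ m, ∀ f ∈ S m, C f ∈ S m) ∧ (∀ i, ∀ f ∈ W₁ i, C f ∈ W₁ i) :=
    fun p q W₁ k hk => gbracket_zero (sub_eq_zero.2 (opL_comm X k.1 (hLX k hk).symm p q k.2.1 k.2.2))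
  obtain ⟨W₁, g₁, s₁⟩ := gstep_exp μ X 0 2 h02 P (hP 0 2 h02) L W hW hL (cross 0 2 W)
  obtain ⟨W₂, g₂, s₂⟩ := gstep_exp μ X 0 1 h01 P (hP 0 1 h01) ((X, 0, 2) :: L) W₁ g₁ s₁ (by
    intro k hk
    rcases List.mem_cons.1 hk with rfl | hk'
    · exact gbracket_zero (by simpa using opL_bracket X 0 1 0 2)
    · exact cross 0 1 W₁ k hk')
  exact gstep_exp μ X 1 2 h12 P (hP 1 2 h12) ((X, 0, 1) :: (X, 0, 2) :: L) W₂ g₂ s₂ (by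
    intro k hk
    rcases List.mem_cons.1 hk with rfl | hk
    · exact gbracket_one X (s₂ (X, 0, 2) (by simp))
    rcases List.mem_cons.1 hk with rfl | hk'
    · exact gbracket_zero (by simpa using opL_bracket X 1 2 0 2)
    · exact cross 1 2 W₂ k hk')

/-- The torus stage of factor `X` (general): the three tori of `E₀₀, E₁₁, E₂₂`. -/
theorem gstageT (X : Fin 3) (P : (ι → Submodule ℂ Poly) → Prop)
    (hP : ∀ p, ∀ W, P W → P (fun i => limW (Tw (nT' X p)).toLinearMap (S (μ i)) (W i)))
    (L : List (Fin 3 × Fin 3 × Fin 3)) (W : ι → Submodule ℂ Poly) (hW : P W)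
    (hL : ∀ k ∈ L, ∀ i, ∀ f ∈ W i, opL k.1 k.2.1 k.2.2 f ∈ W i) :
    ∃ W' : ι → Submodule ℂ Poly, P W' ∧
      ∀ k ∈ (X, (2 : Fin 3), (2 : Fin 3)) :: (X, 1, 1) :: (X, 0, 0) :: L, ∀ i, ∀ f ∈ W' i, opL k.1 k.2.1 k.2.2 f ∈ W' i := by
  obtain ⟨W₁, g₁, s₁⟩ := gstep_tor μ X 0 P (hP 0) L W hW hL
  obtain ⟨W₂, g₂, s₂⟩ := gstep_tor μ X 1 P (hP 1) _ W₁ g₁ s₁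
  exact gstep_tor μ X 2 P (hP 2) _ W₂ g₂ s₂

/-- **THE BOREL LIMIT THEOREM (general form).** Let `W` be any tuple of subspaces, the `i`-th inside
the piece `S (μ i)` (arbitrary index type: e.g. all multidegrees of an ideal), and let `P` be a property of
such tuples that passes to the limit of every one of the line's one-parameter degenerations (the unipotent
`exp(s E_{pq})`, `p ≠ q`, tested through `Hx (-opL X p q) (|μ i| + 1)`, and the tori of the `E_{pp}`, tested
through `Tw (nT' X p)`) — i.e. `P` is CLOSED and `𝔟`-EQUIVARIANT in the sense used by border apolarity.
Then some tuple satisfies `P` and is stable under the whole Borel subalgebra: all `opL X p q`, `p ≤ q`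
(hence all `opU/opV/opW p q`, `p ≤ q`, by `opU_eq`, `opV_eq`, `opW_eq`).  This is the elementary
replacement of the Borel fixed point theorem (CHL 2023 §2.4, BB 2021 Thm 4.3). -/
theorem borel_limit_exists (P : (ι → Submodule ℂ Poly) → Prop)
    (hPexp : ∀ X p q : Fin 3, p ≠ q → ∀ W, P W → P (fun i => limW (Hx (-opL X p q) (nOf (μ i))) (S (μ i)) (W i)))
    (hPtor : ∀ X p : Fin 3, ∀ W, P W → P (fun i => limW (Tw (nT' X p)).toLinearMap (S (μ i)) (W i)))
    (W₀ : ι → Submodule ℂ Poly) (h₀ : P W₀) :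
    ∃ W : ι → Submodule ℂ Poly, P W ∧ ∀ X p q : Fin 3, p ≤ q → ∀ i, ∀ f ∈ W i, opL X p q f ∈ W i := by
  obtain ⟨W₁, g₁, s₁⟩ := gstageN μ 0 P (hPexp 0) [] (by simp) W₀ h₀ (by simp)
  obtain ⟨W₂, g₂, s₂⟩ := gstageN μ 1 P (hPexp 1) _ (by
    intro k hk; simp only [List.mem_cons, List.mem_nil_iff, or_false] at hk
    rcases hk with rfl | rfl | rfl <;> decide) W₁ g₁ s₁
  obtain ⟨W₃, g₃, s₃⟩ := gstageN μ 2 P (hPexp 2) _ (by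
    intro k hk; simp only [List.mem_cons, List.mem_nil_iff, or_false] at hk
    rcases hk with rfl | rfl | rfl | rfl | rfl | rfl <;> decide) W₂ g₂ s₂
  obtain ⟨W₄, g₄, s₄⟩ := gstageT μ 0 P (hPtor 0) _ W₃ g₃ s₃
  obtain ⟨W₅, g₅, s₅⟩ := gstageT μ 1 P (hPtor 1) _ W₄ g₄ s₄
  obtain ⟨W₆, g₆, s₆⟩ := gstageT μ 2 P (hPtor 2) _ W₅ g₅ s₅
  refine ⟨W₆, g₆, fun X p q hpq i f hf => s₆ (X, p, q) ?_ i f hf⟩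
  revert X p q
  decide

/-- The conclusion in the line's vocabulary: `P` together with `IsBFixed` of every piece. -/
theorem borel_limit_exists_isBFixed (P : (ι → Submodule ℂ Poly) → Prop)
    (hPexp : ∀ X p q : Fin 3, p ≠ q → ∀ W, P W → P (fun i => limW (Hx (-opL X p q) (nOf (μ i))) (S (μ i)) (W i)))
    (hPtor : ∀ X p : Fin 3, ∀ W, P W → P (fun i => limW (Tw (nT' X p)).toLinearMap (S (μ i)) (W i)))
    (W₀ : ι → Submodule ℂ Poly) (h₀ : P W₀) :
    ∃ W : ι → Submodule ℂ Poly, P W ∧ ∀ i, IsBFixed (W i) := by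
  obtain ⟨W, hW, hs⟩ := borel_limit_exists μ P hPexp hPtor W₀ h₀
  refine ⟨W, hW, fun i p q hpq => ⟨fun f hf => ?_, fun f hf => ?_, fun f hf => ?_⟩⟩
  · rw [opU_eq]; exact hs 0 p q hpq i f hf
  · rw [opV_eq]; exact hs 1 p q hpq i f hf
  · rw [opW_eq]; exact hs 2 p q hpq i f hf

end General


/-- **Part 11 of `stub_borelNormalForm` (registered helper stub): the general Borel limit theorem** —
a limit-closed property of tuples of subspaces of the pieces is attained by a `𝔟`-fixed tuple. -/
theorem stub_borelNormalForm_borel : ∀ {ι : Type} (μ : ι → MDeg) (P : (ι → Submodule ℂ Poly) → Prop),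
    (∀ X p q : Fin 3, p ≠ q → ∀ W, P W →
      P (fun i => BorelLimit.limW (BorelLimit.Hx (-opL X p q) (nOf (μ i))) (S (μ i)) (W i))) →
    (∀ X p : Fin 3, ∀ W, P W → P (fun i => BorelLimit.limW (BorelLimit.Tw (nT' X p)).toLinearMap (S (μ i)) (W i))) →
    ∀ W₀ : ι → Submodule ℂ Poly, P W₀ → ∃ W : ι → Submodule ℂ Poly, P W ∧ ∀ i, IsBFixed (W i) :=
  fun μ P hPexp hPtor W₀ h₀ => borel_limit_exists_isBFixed μ P hPexp hPtor W₀ h₀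

end Summit.MatrixMultiplication.MatrixMultiplication.Theorems.SymbolicSquare

end
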